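import Mathlib
import Summits.ValiantsHypothesis.ValiantsHypothesis.Theorems.DivisionGapPerMultiplesHardStubHostTorus
import Literature.Computability.AlgebraicComplexity.ArithCircuitProofs
import Literature.Computability.AlgebraicComplexity.PermanentIrreducible

/-!
# `DivisionGap.PerMultiplesHard` (stmt-ValiantsHypothesis-5068), line `uncharged-face-walk`:
a full margin slice of a cofactor is free at any host (stub `stub_marginSlice`)

For a face `G ⊆ [n]²` let `per_G := ∑_{σ ⊆ G} x^{μ_σ}` be the face permanent (the sum of the
permutation monomials of the permutations whose graph lies inside `G`).  For every nonzero
`q ∈ ℝ≥0[x_ij]` (`n × n` variables) there are margins `r, c : Fin n → ℕ` and a nonzero `q'` whose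
support is EXACTLY the set of monomials of `q` with row sums `r` and column sums `c`, with
`L⁺(per_G · q') ≤ L⁺(per_G · q)` for the tree's monotone fan-in-two `complexity` over `ℝ≥0`.

Mechanism.  `q' := T q`, the iterated top component of `q` over the `2n` row/column indicator
weights (`List.foldr topComponent`, exactly as in the landed `HostTorus.exists_torus_subsum_le`).
The face permanent is homogeneous of weight `1` for each of these weights, so the iteration is
free (`Torus.complexity_mul_foldr_topComponent_le`), and `T q ≠ 0` is torus-homogeneous: its
margins `(r, c)` are read off any monomial `m₀` of `T q`, and `supp (T q) ⊆ supp q`.  The new point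
is the reverse inclusion (`mem_support_foldr_topComponent`): a monomial `m` of `q` having the same
weight as the survivor `m₀` for EVERY weight of the list survives every step of the fold, since at
each step the top weighted degree is attained by `m₀`.  Hence
`supp (T q) = {m ∈ supp q : rows m = r, cols m = c}` — the lexicographically maximal margin class
of `q` (this is the iterated-indicator form of the base-`B` row/column potentials `B^i`, `B^j`).

Log (stub-worker): written on the landed `Torus` / `HostTorus` / `TopComponentFree` API.
[folklore]
-/

noncomputable section

set_option linter.dupNamespace false

open MvPolynomial Literature.Computability.AlgebraicComplexity
open scoped NNReal BigOperators
open Summit.ValiantsHypothesis.ValiantsHypothesis.Theorems.ZeroOneTransfer.Negative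

namespace Summit.ValiantsHypothesis.ValiantsHypothesis.Theorems.DivisionGap.PerMultiplesHard.MarginSlice

variable {σ : Type*}

/-! ### Survivors of iterated top components -/

/-- Support of a top component: the monomials of `p` of top weighted degree. [folklore] -/
theorem mem_support_topComponent_iff (w : σ → ℕ) (p : MvPolynomial σ ℝ≥0) (d : σ →₀ ℕ) :
    d ∈ (topComponent w p).support ↔
      d ∈ p.support ∧ Finsupp.weight w d = weightedTotalDegree w p := by
  rw [mem_support_iff, mem_support_iff, coeff_topComponent]
  split_ifs with h
  · simp [h]
  · simp [h]

/-- **Survivors of iterated top components.** If `m₀` survives the iterated top components over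
`ws` and a monomial `m` of `p` has the same `w`-weight as `m₀` for every `w ∈ ws`, then `m`
survives as well: at each step the top weighted degree is the weight of `m₀`. [folklore] -/
theorem mem_support_foldr_topComponent (ws : List (σ → ℕ)) (p : MvPolynomial σ ℝ≥0)
    {m₀ m : σ →₀ ℕ} (hm : m ∈ p.support) :
    m₀ ∈ (ws.foldr topComponent p).support →
      (∀ w ∈ ws, Finsupp.weight w m = Finsupp.weight w m₀) →
        m ∈ (ws.foldr topComponent p).support := by
  induction ws with
  | nil => exact fun _ _ => hm
  | cons w ws ih =>
    intro hm₀ hw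
    rw [List.foldr_cons, mem_support_topComponent_iff] at hm₀ ⊢
    exact ⟨ih hm₀.1 fun w' hw' => hw w' (List.mem_cons_of_mem _ hw'),
      (hw w List.mem_cons_self).trans hm₀.2⟩

/-! ### The stub -/

variable {n : ℕ}

-- adapted from `HostTorus.exists_torus_subsum_le` (plus the reverse inclusion of the support)
/-- **A full margin slice of the cofactor is free at any host** (stub `stub_marginSlice` of line
`uncharged-face-walk`): for every face `G` and every nonzero `q` there are margins `(r, c)` and a
nonzero `q'` whose support is exactly the set of monomials of `q` with row sums `r` and column
sums `c`, with `L⁺(per_G · q') ≤ L⁺(per_G · q)` — `q'` is the iterated top component of `q` over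
the `2n` row/column indicator weights (free, since `per_G` is homogeneous of weight `1` for each),
its support is the lexicographically maximal margin class of `q`. [folklore] -/
theorem stub_marginSlice :
    ∀ (n : ℕ) (G : Finset (Fin n × Fin n)) (q : MvPolynomial (Fin n × Fin n) ℝ≥0), q ≠ 0 →
      ∃ (q' : MvPolynomial (Fin n × Fin n) ℝ≥0) (r c : Fin n → ℕ), q' ≠ 0 ∧
        (∀ m : (Fin n × Fin n) →₀ ℕ, m ∈ q'.support ↔
          m ∈ q.support ∧ (∀ i, ∑ j, m (i, j) = r i) ∧ (∀ j, ∑ i, m (i, j) = c j)) ∧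
        complexity ((∑ σ ∈ (Finset.univ : Finset (Equiv.Perm (Fin n))).filter (fun σ => ∀ i, (σ i, i) ∈ G),
            monomial (permMonomial σ) (1 : ℝ≥0)) * q') ≤
          complexity ((∑ σ ∈ (Finset.univ : Finset (Equiv.Perm (Fin n))).filter (fun σ => ∀ i, (σ i, i) ∈ G),
            monomial (permMonomial σ) (1 : ℝ≥0)) * q) := by
  intro n G q hq
  classical
  let ws : List (Fin n × Fin n → ℕ) :=
    (List.finRange n).map (fun i v => if v.1 = i then 1 else 0) ++
      (List.finRange n).map (fun j v => if v.2 = j then 1 else 0)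
  have hrow_mem : ∀ i : Fin n, (fun v : Fin n × Fin n => if v.1 = i then 1 else 0) ∈ ws :=
    fun i => List.mem_append_left _ (List.mem_map.2 ⟨i, List.mem_finRange i, rfl⟩)
  have hcol_mem : ∀ j : Fin n, (fun v : Fin n × Fin n => if v.2 = j then 1 else 0) ∈ ws :=
    fun j => List.mem_append_right _ (List.mem_map.2 ⟨j, List.mem_finRange j, rfl⟩)
  have hne : ws.foldr topComponent q ≠ 0 := Torus.foldr_topComponent_ne_zero ws hq
  obtain ⟨m₀, hm₀⟩ := support_nonempty.2 hne
  refine ⟨ws.foldr topComponent q, fun i => ∑ j, m₀ (i, j), fun j => ∑ i, m₀ (i, j), hne,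
    fun m => ⟨fun hm => ⟨?_, fun i => ?_, fun j => ?_⟩, fun hm => ?_⟩, ?_⟩
  · -- sub-sum
    exact HostTorus.support_foldr_topComponent_subset ws q hm
  · -- common row margins
    obtain ⟨d, hd⟩ := Torus.isWeightedHomogeneous_foldr_topComponent ws q (hrow_mem i)
    show ∑ j, m (i, j) = ∑ j, m₀ (i, j)
    rw [← Torus.weight_rowIndicator i m, ← Torus.weight_rowIndicator i m₀,
      hd (mem_support_iff.1 hm), hd (mem_support_iff.1 hm₀)]
  · -- common column margins
    obtain ⟨d, hd⟩ := Torus.isWeightedHomogeneous_foldr_topComponent ws q (hcol_mem j)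
    show ∑ i, m (i, j) = ∑ i, m₀ (i, j)
    rw [← Torus.weight_colIndicator j m, ← Torus.weight_colIndicator j m₀,
      hd (mem_support_iff.1 hm), hd (mem_support_iff.1 hm₀)]
  · -- the whole margin class survives
    obtain ⟨hmq, hr, hc⟩ := hm
    refine mem_support_foldr_topComponent ws q hmq hm₀ fun w hw => ?_
    rcases List.mem_append.1 hw with hw' | hw'
    · obtain ⟨i, -, rfl⟩ := List.mem_map.1 hw'
      exact (Torus.weight_rowIndicator i m).trans
        ((hr i).trans (Torus.weight_rowIndicator i m₀).symm)
    · obtain ⟨j, -, rfl⟩ := List.mem_map.1 hw'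
      exact (Torus.weight_colIndicator j m).trans
        ((hc j).trans (Torus.weight_colIndicator j m₀).symm)
  · -- free: `per_G` is homogeneous for every weight of the list
    refine Torus.complexity_mul_foldr_topComponent_le ws _ q fun w hw => ?_
    rcases List.mem_append.1 hw with hw' | hw'
    · obtain ⟨i, -, rfl⟩ := List.mem_map.1 hw'
      exact ⟨1, HostTorus.isWeightedHomogeneous_facePer_row G i⟩
    · obtain ⟨j, -, rfl⟩ := List.mem_map.1 hw'
      exact ⟨1, HostTorus.isWeightedHomogeneous_facePer_col G j⟩

end Summit.ValiantsHypothesis.ValiantsHypothesis.Theorems.DivisionGap.PerMultiplesHard.MarginSlice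

end
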